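import Summits.Parity.BatemanHorn.Theorems.SoloInformedTwinBoxes
import Summits.Parity.BatemanHorn.Theorems.SoloInformedMoebiusSWHyp
import Literature.NumberTheory.Sieve.BombieriFriedlanderIwaniecBilinearProofs

/-!
# The unbalanced twin sum, regime (1b) — II: BFI Theorem 0 (b) on one box

Soloist file (informed mode), second file of step F4 of the kernel project for (F′).  For ONE
interior product box of `SoloInformedTwinBoxes` (`k ∼ M = boxLow_i`, `e ∼ N = boxLow_l`, `x_b = MN`)
the free box sums over the moduli `q ≤ z` prime to `r₀` are bounded (`sum_abs_freeSum_le`) by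
`C Δ x_b (log hi)^j (1 + log z)⁸ (log x_b)^{−A'}`: the discrepancies by the bilinear
Bombieri–Vinogradov theorem (BFI 1986 Theorem 0 (b), PROVED in the tree as
`BombieriFriedlanderIwaniecTheorem0b_holds`; `α = 𝟙_{k-box}`, `β =` the Möbius log-power piece,
(A₂) by `siegelWalfiszHyp_moebiusLogPiece`), the mean terms `φ(q)⁻¹(∑_{(k,q)=1} α)(∑_{(e,q)=1} β)`
by Siegel–Walfisz for `μ` with a coprimality condition and `∑_q 4^{ω(q)}/φ(q) ≤ (1 + log z)⁸`.
-/

namespace Summit.Parity.BatemanHorn.Theorems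

open Finset Real
open scoped ArithmeticFunction.Moebius
open Literature.NumberTheory.Sieve Literature.NumberTheory.Sieve.BFI
  Literature.NumberTheory.Sieve.BVMoebius

/-! ### 1. Möbius sums with a coprimality condition -/

/-- **Siegel–Walfisz for `μ` with a coprimality condition** (modulus `1`): for `B ≥ 0` there is
`C ≥ 0` with `|∑_{n ≤ t, (n,r)=1} μ(n)| ≤ C 4^{ω(r)} x (log x)^{−B}` for `3 ≤ x`, `1 ≤ t ≤ x`, `r ≥ 1`. -/
theorem exists_moebius_coprime_bound {B : ℝ} (hB : 0 ≤ B) :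
    ∃ C : ℝ, 0 ≤ C ∧ ∀ x : ℝ, 3 ≤ x → ∀ r : ℕ, r ≠ 0 → ∀ t : ℕ, 1 ≤ t → (t : ℝ) ≤ x →
      |∑ n ∈ (Icc 1 t).filter (fun n : ℕ => n.Coprime r), (μ n : ℝ)| ≤
        C * (4 : ℝ) ^ r.primeFactors.card * x / Real.log x ^ B := by
  obtain ⟨C, hC0, hC⟩ := Polymath8a.sum_moebius_coprime_progression_le_uniform
    Literature.NumberTheory.LFunctions.SiegelWalfiszMoebius_holds (A := 1) one_pos hB
  refine ⟨C, hC0, fun x hx r hr t ht htx => ?_⟩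
  have hlog : ((1 : ℕ) : ℝ) ≤ Real.log x ^ (1 : ℝ) := by
    rw [Real.rpow_one, Nat.cast_one]
    have h1 : Real.exp 1 ≤ x := le_trans Real.exp_one_lt_three.le hx
    have h2 := Real.log_le_log (Real.exp_pos 1) h1
    rwa [Real.log_exp] at h2
  have h := hC x (by linarith) 1 le_rfl hlog (0 : ZMod 1) (isUnit_of_subsingleton _) r hr (t : ℝ)
    (by exact_mod_cast ht) htx
  rw [Nat.floor_natCast] at h
  have hfilt : (Icc 1 t).filter (fun n : ℕ => ((n : ℕ) : ZMod 1) = 0 ∧ n.Coprime r) =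
      (Icc 1 t).filter (fun n : ℕ => n.Coprime r) :=
    Finset.filter_congr fun n _ => by simp [Subsingleton.elim ((n : ℕ) : ZMod 1) 0]
  rwa [hfilt] at h

/-- **The `e`-sum of a piece with a coprimality condition**: if `|∑_{n ≤ t, (n, qr₀) = 1} μ(n)| ≤ Mμ`
for all `1 ≤ t ≤ b` (`Mμ ≥ 0`), then for `N ≥ 0`, `N < a + 1`, `b ≤ 2N`:
`|∑_{n ∼ N, (n,q)=1} β_n| ≤ 2^{j+1} Mμ (log b)^j` for the piece `β` on `(a, b]`
(partial summation, `abs_sum_Ioc_ite_moebius_log_pow_le`). -/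
theorem abs_sum_dyadic_coprime_piece_le {N : ℝ} (hN : 0 ≤ N) {a b : ℕ} (ha : N < (a : ℝ) + 1)
    (hb : (b : ℝ) ≤ 2 * N) (j r₀ q : ℕ) {Mμ : ℝ} (hM0 : 0 ≤ Mμ)
    (hM : ∀ t : ℕ, 1 ≤ t → t ≤ b →
      |∑ n ∈ (Icc 1 t).filter (fun n : ℕ => n.Coprime (q * r₀)), (μ n : ℝ)| ≤ Mμ) :
    |∑ n ∈ dyadic N, (if n.Coprime q then moebiusLogPiece j r₀ a b n else 0)| ≤
      2 ^ (j + 1) * Mμ * Real.log b ^ j := by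
  rw [← Finset.sum_filter, sum_filter_dyadic_moebiusLogPiece hN ha hb (fun n : ℕ => n.Coprime q)]
  rcases le_or_gt a b with hab | hab
  · refine abs_sum_Ioc_ite_moebius_log_pow_le (Q := fun n : ℕ => n.Coprime q ∧ n.Coprime r₀) hM0
      (fun t ht htb => ?_) j hab
    have hfilt : (Icc 1 t).filter (fun n : ℕ => n.Coprime q ∧ n.Coprime r₀) =
        (Icc 1 t).filter (fun n : ℕ => n.Coprime (q * r₀)) :=
      Finset.filter_congr fun n _ => Nat.coprime_mul_iff_right.symm
    rw [hfilt]
    exact hM t ht htb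
  · rw [Finset.Ioc_eq_empty (by omega), Finset.sum_empty, abs_zero]
    positivity

/-- The mean-term factorisation: `∑_m ∑_n 𝟙[(mn,q)=1] f(m) g(n) = (∑_{(m,q)=1} f)(∑_{(n,q)=1} g)`. -/
theorem sum_sum_coprime_mul_eq (s t : Finset ℕ) (q : ℕ) (f g : ℕ → ℝ) :
    ∑ m ∈ s, ∑ n ∈ t, (if (m * n).Coprime q then f m * g n else 0) =
      (∑ m ∈ s, if m.Coprime q then f m else 0) * (∑ n ∈ t, if n.Coprime q then g n else 0) := by
  rw [Finset.sum_mul_sum]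
  refine Finset.sum_congr rfl fun m _ => Finset.sum_congr rfl fun n _ => ?_
  by_cases h1 : m.Coprime q
  · by_cases h2 : n.Coprime q
    · rw [if_pos (Nat.Coprime.mul_left h1 h2), if_pos h1, if_pos h2]
    · rw [if_neg (fun h => h2 (Nat.Coprime.coprime_mul_left h)), if_pos h1, if_neg h2, mul_zero]
  · rw [if_neg (fun h => h1 (Nat.Coprime.coprime_mul_right h)), if_neg h1, zero_mul]

/-- `ω(q r₀) ≤ ω(q) + 1` for `r₀ ∈ {1, 2}`. -/
theorem card_primeFactors_mul_le {r₀ : ℕ} (hr₀ : r₀ = 1 ∨ r₀ = 2) (q : ℕ) :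
    (q * r₀).primeFactors.card ≤ q.primeFactors.card + 1 := by
  rcases Nat.eq_zero_or_pos q with rfl | hq
  · simp
  rcases hr₀ with rfl | rfl
  · simp
  · rw [Nat.primeFactors_mul hq.ne' two_ne_zero, Nat.prime_two.primeFactors]
    exact (Finset.card_union_le _ _).trans (by simp)

/-! ### 2. Norms -/

/-- `‖𝟙_S‖² ≤ #S` over any dyadic range. -/
theorem l2Sq_indicator_le (M : ℝ) (S : Finset ℕ) :
    l2Sq M (fun m : ℕ => if m ∈ S then (1 : ℝ) else 0) ≤ #S := by
  unfold l2Sq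
  calc ∑ m ∈ dyadic M, (if m ∈ S then (1 : ℝ) else 0) ^ 2
      = ∑ m ∈ dyadic M, (if m ∈ S then (1 : ℝ) else 0) := by
        refine Finset.sum_congr rfl fun m _ => ?_; split_ifs <;> simp
    _ = #((dyadic M).filter (fun m => m ∈ S)) := by
        rw [← Finset.sum_filter]; simp
    _ ≤ #S := by
        exact_mod_cast Finset.card_le_card (fun m hm => (Finset.mem_filter.1 hm).2)

/-- `‖β‖² ≤ (b − a) (log b)^{2j}` for the piece on `(a, b]`. -/
theorem l2Sq_moebiusLogPiece_le (N : ℝ) (j r₀ a b : ℕ) :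
    l2Sq N (moebiusLogPiece j r₀ a b) ≤ ((b - a : ℕ) : ℝ) * Real.log b ^ (2 * j) := by
  unfold l2Sq
  have hlogb : 0 ≤ Real.log b := Real.log_natCast_nonneg b
  calc ∑ n ∈ dyadic N, moebiusLogPiece j r₀ a b n ^ 2
      ≤ ∑ n ∈ dyadic N, (if n ∈ Ioc a b then Real.log b ^ (2 * j) else 0) := by
        refine Finset.sum_le_sum fun n _ => ?_
        split_ifs with hn
        · have hn1 : (1 : ℝ) ≤ n := by
            have := (Finset.mem_Ioc.1 hn).1
            exact_mod_cast (show 1 ≤ n by omega)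
          have hnb : (n : ℝ) ≤ b := by exact_mod_cast (Finset.mem_Ioc.1 hn).2
          have h1 := abs_moebiusLogPiece_le j r₀ a b n
          rw [abs_of_nonneg (Real.log_nonneg hn1)] at h1
          calc moebiusLogPiece j r₀ a b n ^ 2 = |moebiusLogPiece j r₀ a b n| ^ 2 := (sq_abs _).symm
            _ ≤ (Real.log n ^ j) ^ 2 := pow_le_pow_left₀ (abs_nonneg _) h1 2
            _ ≤ (Real.log b ^ j) ^ 2 := pow_le_pow_left₀ (by positivity)
                (pow_le_pow_left₀ (Real.log_nonneg hn1) (Real.log_le_log (by linarith) hnb) j) 2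
            _ = Real.log b ^ (2 * j) := by rw [← pow_mul, mul_comm]
        · rw [moebiusLogPiece_eq_zero_of_not_mem hn]; simp
    _ = #((dyadic N).filter (fun n => n ∈ Ioc a b)) * Real.log b ^ (2 * j) := by
        rw [← Finset.sum_filter, Finset.sum_const, nsmul_eq_mul]
    _ ≤ ((b - a : ℕ) : ℝ) * Real.log b ^ (2 * j) := by
        refine mul_le_mul_of_nonneg_right ?_ (by positivity)
        have h := Finset.card_le_card (fun n hn => (Finset.mem_filter.1 hn).2 :
          (dyadic N).filter (fun n => n ∈ Ioc a b) ⊆ Ioc a b)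
        rw [Nat.card_Ioc] at h
        exact_mod_cast h

/-- `√(2ΔM) √(2ΔN) (MN)^{1/2} = 2Δ MN` (`Δ, M, N ≥ 0`). -/
theorem sqrt_mul_sqrt_mul_rpow_half {Δ M N : ℝ} (hΔ : 0 ≤ Δ) (hM : 0 ≤ M) (hN : 0 ≤ N) :
    Real.sqrt (2 * Δ * M) * Real.sqrt (2 * Δ * N) * (M * N) ^ (1 / 2 : ℝ) = 2 * Δ * (M * N) := by
  rw [← Real.sqrt_eq_rpow, ← Real.sqrt_mul (by positivity), ← Real.sqrt_mul (by positivity)]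
  rw [show 2 * Δ * M * (2 * Δ * N) * (M * N) = (2 * Δ * (M * N)) ^ 2 by ring]
  exact Real.sqrt_sq (by positivity)

/-! ### 3. Theorem 0 (b) and the mean terms on one box -/

set_option maxHeartbeats 1600000 in
/-- **One interior box** (`M = boxLow_i`, `N = boxLow_l`, `x_b = MN`): for the family `r₀ ∈ {1,2}`
with `a` prime to every modulus prime to `r₀`, and `ε', A' > 0`, there are `B₁ > 0`, `C ≥ 0`, `X₁`
such that for every box with `x_b ≥ X₁`, `x_b^{ε'} ≤ N ≤ x_b^{1−ε'}`, `z ≤ x_b^{1/2}(log x_b)^{−B₁}`,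
`ΔM ≥ 1`, `ΔN ≥ 1`, `0 < Δ ≤ 1`:
`∑_{q ≤ z, (q,r₀)=1} |freeSum(q; i, l)| ≤ C Δ x_b (log hi)^j (1 + log z)⁸ (log x_b)^{−A'}`
(Theorem 0 (b) for the discrepancies, Siegel–Walfisz for the mean terms).
[cite: BombieriFriedlanderIwaniecActa1986, §2 Theorem 0 (b) p. 211] -/
theorem sum_abs_freeSum_le (j : ℕ) {r₀ : ℕ} {a : ℤ} (hr₀ : r₀ = 1 ∨ r₀ = 2)
    (ha : ∀ q : ℕ, q.Coprime r₀ → IsCoprime (q : ℤ) a) {ε' A' : ℝ} (hε' : 0 < ε') (hA' : 0 < A') :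
    ∃ B₁ C X₁ : ℝ, 0 < B₁ ∧ 0 ≤ C ∧ ∀ (hi K₀ K z i l : ℕ) (Δ : ℝ), 0 < Δ → Δ ≤ 1 →
      X₁ ≤ boxLow (K : ℝ) Δ i * boxLow (hi : ℝ) Δ l →
      (boxLow (K : ℝ) Δ i * boxLow (hi : ℝ) Δ l) ^ ε' ≤ boxLow (hi : ℝ) Δ l →
      boxLow (hi : ℝ) Δ l ≤ (boxLow (K : ℝ) Δ i * boxLow (hi : ℝ) Δ l) ^ (1 - ε') →
      (z : ℝ) ≤ (boxLow (K : ℝ) Δ i * boxLow (hi : ℝ) Δ l) ^ (1 / 2 : ℝ) /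
        Real.log (boxLow (K : ℝ) Δ i * boxLow (hi : ℝ) Δ l) ^ B₁ →
      1 ≤ Δ * boxLow (K : ℝ) Δ i → 1 ≤ Δ * boxLow (hi : ℝ) Δ l →
      ∑ q ∈ (Icc 1 z).filter (fun q : ℕ => q.Coprime r₀), |freeSum j r₀ hi a K₀ K Δ q i l| ≤
        C * Δ * (boxLow (K : ℝ) Δ i * boxLow (hi : ℝ) Δ l) * Real.log hi ^ j *
          (1 + Real.log z) ^ 8 / Real.log (boxLow (K : ℝ) Δ i * boxLow (hi : ℝ) Δ l) ^ A' := by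
  have hr₀0 : r₀ ≠ 0 := by rcases hr₀ with rfl | rfl <;> norm_num
  obtain ⟨Csw, hCsw⟩ := siegelWalfiszHyp_moebiusLogPiece j hr₀0
  obtain ⟨B₁, C₀, x₀, hB₁, hC₀, hBFI⟩ :=
    BombieriFriedlanderIwaniecTheorem0b_holds.nonneg_const hε' hA' (B := 2) (by norm_num) Csw
  obtain ⟨CP, hCP0, hCP⟩ := exists_moebius_coprime_bound hA'.le
  refine ⟨B₁, 2 * C₀ + 2 ^ (j + 6) * 5 * CP * ε' ^ (-A'), max x₀ 9, hB₁, by positivity, ?_⟩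
  intro hi K₀ K z i l Δ hΔ hΔ1 hX₁ hNlo hNhi hz hΔM hΔN
  set M : ℝ := boxLow (K : ℝ) Δ i with hMdef
  set N : ℝ := boxLow (hi : ℝ) Δ l with hNdef
  set xb : ℝ := M * N with hxb
  have hM0' : 0 ≤ M := by rw [hMdef]; unfold boxLow; positivity
  have hN0' : 0 ≤ N := by rw [hNdef]; unfold boxLow; positivity
  have hM1 : 1 ≤ M := by nlinarith
  have hN1 : 1 ≤ N := by nlinarith
  have hx9 : 9 ≤ xb := (le_max_right _ _).trans hX₁
  have hx₀ : x₀ ≤ xb := (le_max_left _ _).trans hX₁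
  have hlogxb : 0 < Real.log xb := Real.log_pos (by linarith)
  have hbH : boxHigh (hi : ℝ) Δ l = (1 + Δ) * N := boxHigh_eq_mul_boxLow (by linarith) l
  have hbHhi : boxHigh (hi : ℝ) Δ l ≤ hi := boxHigh_le_self (Nat.cast_nonneg hi) hΔ.le l
  have hhi1 : (1 : ℝ) ≤ hi := by nlinarith
  have hloghi : 0 ≤ Real.log hi := Real.log_nonneg hhi1
  have hlogz0 : 0 ≤ Real.log z := Real.log_natCast_nonneg z
  have hrA : 0 ≤ Real.log xb ^ A' := by positivity
  set Kb := (Ioc K₀ K).filter (fun k : ℕ => InBox (K : ℝ) Δ i k ∧ k.Coprime r₀) with hKb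
  set α : ℕ → ℝ := fun m => if m ∈ Kb then (1 : ℝ) else 0 with hα
  set b : ℕ := ⌊boxHigh (hi : ℝ) Δ l⌋₊ with hb
  set β : ℕ → ℝ := moebiusLogPiece j r₀ ⌊N⌋₊ b with hβ
  have hbH0 : 0 ≤ boxHigh (hi : ℝ) Δ l := by rw [hbH]; positivity
  have hb2 : (b : ℝ) ≤ 2 * N := by
    calc (b : ℝ) ≤ boxHigh (hi : ℝ) Δ l := Nat.floor_le hbH0
      _ = (1 + Δ) * N := hbH
      _ ≤ 2 * N := by nlinarith
  have hbhi : (b : ℝ) ≤ hi := (Nat.floor_le hbH0).trans hbHhi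
  have hlogb0 : 0 ≤ Real.log b := Real.log_natCast_nonneg b
  have hlogb : Real.log b ≤ Real.log hi := by
    rcases Nat.eq_zero_or_pos b with hb0 | hbpos
    · rw [hb0, Nat.cast_zero, Real.log_zero]; exact hloghi
    · exact Real.log_le_log (by exact_mod_cast hbpos) hbhi
  have hβSW : SiegelWalfiszHyp N 2 Csw β := hCsw N hN1 ⌊N⌋₊ b (Nat.lt_floor_add_one N) hb2
  have hcardKb : (#Kb : ℝ) ≤ 2 * Δ * M := by
    calc (#Kb : ℝ) ≤ boxHigh (K : ℝ) Δ i - boxLow (K : ℝ) Δ i + 1 :=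
          card_filter_inBox_le (T := (K : ℝ)) (Nat.cast_nonneg K) hΔ.le i (Ioc K₀ K)
            (fun k : ℕ => k.Coprime r₀)
      _ = Δ * M + 1 := by rw [boxHigh_eq_mul_boxLow (by linarith) i]; ring
      _ ≤ 2 * Δ * M := by linarith
  set a' : ℕ → ℤ := fun q => if q.Coprime r₀ then a else 1 with ha'
  have ha'cop : ∀ q : ℕ, IsCoprime (q : ℤ) (a' q) := by
    intro q
    show IsCoprime (q : ℤ) (if q.Coprime r₀ then a else 1)
    split_ifs with h
    · exact ha q h
    · exact isCoprime_one_right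
  have hmain := hBFI xb hx₀ M N rfl hNlo hNhi β hβSW α (z : ℝ) hz a' ha'cop
  rw [Nat.floor_natCast] at hmain
  have hnα : Real.sqrt (l2Sq M α) ≤ Real.sqrt (2 * Δ * M) := by
    refine Real.sqrt_le_sqrt ((l2Sq_indicator_le M Kb).trans hcardKb)
  have hnβ : Real.sqrt (l2Sq N β) ≤ Real.sqrt (2 * Δ * N) * Real.log hi ^ j := by
    have e1 : ((b - ⌊N⌋₊ : ℕ) : ℝ) ≤ 2 * Δ * N := by
      rcases le_or_gt ⌊N⌋₊ b with h | h
      · rw [Nat.cast_sub h]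
        have f1 : (b : ℝ) ≤ (1 + Δ) * N := (Nat.floor_le hbH0).trans hbH.le
        have f2 : N < (⌊N⌋₊ : ℝ) + 1 := Nat.lt_floor_add_one N
        nlinarith
      · rw [Nat.sub_eq_zero_of_le h.le, Nat.cast_zero]; positivity
    have h1 : l2Sq N β ≤ (2 * Δ * N) * (Real.log hi ^ j) ^ 2 :=
      calc l2Sq N β ≤ ((b - ⌊N⌋₊ : ℕ) : ℝ) * Real.log b ^ (2 * j) :=
            l2Sq_moebiusLogPiece_le N j r₀ ⌊N⌋₊ b
        _ ≤ (2 * Δ * N) * Real.log hi ^ (2 * j) :=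
            mul_le_mul e1 (pow_le_pow_left₀ hlogb0 hlogb _) (pow_nonneg hlogb0 _) (by positivity)
        _ = (2 * Δ * N) * (Real.log hi ^ j) ^ 2 := by rw [← pow_mul, mul_comm j 2]
    calc Real.sqrt (l2Sq N β) ≤ Real.sqrt ((2 * Δ * N) * (Real.log hi ^ j) ^ 2) := Real.sqrt_le_sqrt h1
      _ = Real.sqrt (2 * Δ * N) * Real.log hi ^ j := by
          rw [Real.sqrt_mul (by positivity), Real.sqrt_sq (by positivity)]
  have hBFIle : ∑ q ∈ Icc 1 z, |bilinDisc (a' q) M N α β q| ≤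
      2 * C₀ * Δ * xb * Real.log hi ^ j / Real.log xb ^ A' := by
    refine hmain.trans ?_
    have h2 : C₀ * Real.sqrt (l2Sq M α) * Real.sqrt (l2Sq N β) * xb ^ (1 / 2 : ℝ) ≤
        C₀ * Real.sqrt (2 * Δ * M) * (Real.sqrt (2 * Δ * N) * Real.log hi ^ j) * xb ^ (1 / 2 : ℝ) := by
      gcongr
    refine (div_le_div_of_nonneg_right h2 hrA).trans (le_of_eq ?_)
    have e := sqrt_mul_sqrt_mul_rpow_half hΔ.le hM0' hN0'
    calc C₀ * Real.sqrt (2 * Δ * M) * (Real.sqrt (2 * Δ * N) * Real.log hi ^ j) * xb ^ (1 / 2 : ℝ) /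
          Real.log xb ^ A'
        = C₀ * Real.log hi ^ j * (Real.sqrt (2 * Δ * M) * Real.sqrt (2 * Δ * N) * xb ^ (1 / 2 : ℝ)) /
            Real.log xb ^ A' := by ring
      _ = 2 * C₀ * Δ * xb * Real.log hi ^ j / Real.log xb ^ A' := by rw [e]; ring
  have hdecomp : ∀ q ∈ (Icc 1 z).filter (fun q : ℕ => q.Coprime r₀),
      freeSum j r₀ hi a K₀ K Δ q i l = bilinDisc (a' q) M N α β q +
        (∑ m ∈ dyadic M, ∑ n ∈ dyadic N, if (m * n).Coprime q then α m * β n else 0) /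
          (Nat.totient q : ℝ) := by
    intro q hq
    have hcop : q.Coprime r₀ := (Finset.mem_filter.1 hq).2
    have haq : a' q = a := by show (if q.Coprime r₀ then a else 1) = a; rw [if_pos hcop]
    rw [haq, freeSum_eq_bilinear hΔ.le hΔ1 j r₀ hi a K₀ K q i l]
    unfold bilinDisc
    rw [sub_add_cancel]
  set W : ℝ := CP * (5 * N) * (ε' * Real.log xb) ^ (-A') with hW
  have hW0 : 0 ≤ W := by positivity
  have hSWq : ∀ q : ℕ, 1 ≤ q → ∀ t : ℕ, 1 ≤ t → t ≤ b →
      |∑ n ∈ (Icc 1 t).filter (fun n : ℕ => n.Coprime (q * r₀)), (μ n : ℝ)| ≤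
        (4 : ℝ) ^ (q * r₀).primeFactors.card * W := by
    intro q hq1 t ht htb
    have hx3 : (3 : ℝ) ≤ 2 * N + 3 := by linarith
    have htx : (t : ℝ) ≤ 2 * N + 3 := by
      have : (t : ℝ) ≤ b := by exact_mod_cast htb
      linarith
    refine (hCP (2 * N + 3) hx3 (q * r₀) (Nat.mul_ne_zero (by omega) hr₀0) t ht htx).trans ?_
    have hN_lo : ε' * Real.log xb ≤ Real.log (2 * N + 3) := by
      have e1 : Real.log (xb ^ ε') ≤ Real.log N :=
        Real.log_le_log (Real.rpow_pos_of_pos (by linarith) _) hNlo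
      rw [Real.log_rpow (by linarith)] at e1
      exact e1.trans (Real.log_le_log (by linarith) (by linarith))
    have hpos : 0 < ε' * Real.log xb := mul_pos hε' hlogxb
    have e2 : Real.log (2 * N + 3) ^ (-A') ≤ (ε' * Real.log xb) ^ (-A') :=
      Real.rpow_le_rpow_of_nonpos hpos hN_lo (by linarith)
    rw [div_eq_mul_inv, ← Real.rpow_neg (Real.log_nonneg (by linarith))]
    calc CP * (4 : ℝ) ^ (q * r₀).primeFactors.card * (2 * N + 3) * Real.log (2 * N + 3) ^ (-A')
        ≤ CP * (4 : ℝ) ^ (q * r₀).primeFactors.card * (5 * N) * (ε' * Real.log xb) ^ (-A') :=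
          mul_le_mul (mul_le_mul_of_nonneg_left (by linarith) (by positivity)) e2
            (Real.rpow_nonneg (Real.log_nonneg (by linarith)) _) (by positivity)
      _ = (4 : ℝ) ^ (q * r₀).primeFactors.card * W := by rw [hW]; ring
  have hmean : ∀ q ∈ (Icc 1 z).filter (fun q : ℕ => q.Coprime r₀),
      |∑ m ∈ dyadic M, ∑ n ∈ dyadic N, (if (m * n).Coprime q then α m * β n else 0)| ≤
        (2 * Δ * M) * (2 ^ (j + 1) * ((4 : ℝ) ^ (q * r₀).primeFactors.card * W) * Real.log hi ^ j) := by
    intro q hq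
    have hq1 : 1 ≤ q := (Finset.mem_Icc.1 (Finset.mem_filter.1 hq).1).1
    rw [sum_sum_coprime_mul_eq, abs_mul]
    refine mul_le_mul ?_ ?_ (abs_nonneg _) (by positivity)
    · calc |∑ m ∈ dyadic M, (if m.Coprime q then α m else 0)|
          ≤ ∑ m ∈ dyadic M, |(if m.Coprime q then α m else 0)| := Finset.abs_sum_le_sum_abs _ _
        _ ≤ ∑ m ∈ dyadic M, (if m ∈ Kb then (1 : ℝ) else 0) := by
            refine Finset.sum_le_sum fun m _ => ?_
            show |if m.Coprime q then (if m ∈ Kb then (1 : ℝ) else 0) else 0| ≤ _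
            by_cases h1 : m.Coprime q
            · rw [if_pos h1]
              by_cases h2 : m ∈ Kb
              · rw [if_pos h2, abs_one]
              · rw [if_neg h2, abs_zero]
            · rw [if_neg h1, abs_zero]
              positivity
        _ = #((dyadic M).filter (fun m => m ∈ Kb)) := by rw [← Finset.sum_filter]; simp
        _ ≤ #Kb := by
            exact_mod_cast Finset.card_le_card (fun m hm => (Finset.mem_filter.1 hm).2)
        _ ≤ 2 * Δ * M := hcardKb
    · calc |∑ n ∈ dyadic N, (if n.Coprime q then β n else 0)|
          ≤ 2 ^ (j + 1) * ((4 : ℝ) ^ (q * r₀).primeFactors.card * W) * Real.log b ^ j :=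
            abs_sum_dyadic_coprime_piece_le hN0' (Nat.lt_floor_add_one N) hb2 j r₀ q (by positivity)
              (hSWq q hq1)
        _ ≤ 2 ^ (j + 1) * ((4 : ℝ) ^ (q * r₀).primeFactors.card * W) * Real.log hi ^ j :=
            mul_le_mul_of_nonneg_left (pow_le_pow_left₀ hlogb0 hlogb j) (by positivity)
  have h4 : ∀ q : ℕ, (4 : ℝ) ^ (q * r₀).primeFactors.card ≤ 4 * (4 : ℝ) ^ q.primeFactors.card := by
    intro q
    calc (4 : ℝ) ^ (q * r₀).primeFactors.card ≤ (4 : ℝ) ^ (q.primeFactors.card + 1) :=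
          pow_le_pow_right₀ (by norm_num) (card_primeFactors_mul_le hr₀ q)
      _ = 4 * (4 : ℝ) ^ q.primeFactors.card := by rw [pow_succ]; ring
  have hmeansum : ∑ q ∈ (Icc 1 z).filter (fun q : ℕ => q.Coprime r₀),
      |∑ m ∈ dyadic M, ∑ n ∈ dyadic N, (if (m * n).Coprime q then α m * β n else 0)| /
        (Nat.totient q : ℝ) ≤
      (2 * Δ * M) * (2 ^ (j + 1) * (4 * W) * Real.log hi ^ j) * (1 + Real.log z) ^ 8 := by
    calc ∑ q ∈ (Icc 1 z).filter (fun q : ℕ => q.Coprime r₀),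
          |∑ m ∈ dyadic M, ∑ n ∈ dyadic N, (if (m * n).Coprime q then α m * β n else 0)| /
            (Nat.totient q : ℝ)
        ≤ ∑ q ∈ (Icc 1 z).filter (fun q : ℕ => q.Coprime r₀),
            (2 * Δ * M) * (2 ^ (j + 1) * (4 * W) * Real.log hi ^ j) *
              ((4 : ℝ) ^ q.primeFactors.card / (Nat.totient q : ℝ)) := by
          refine Finset.sum_le_sum fun q hq => ?_
          rw [div_eq_mul_inv]
          have hφ : 0 ≤ ((Nat.totient q : ℕ) : ℝ)⁻¹ := inv_nonneg.2 (Nat.cast_nonneg _)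
          calc |∑ m ∈ dyadic M, ∑ n ∈ dyadic N, (if (m * n).Coprime q then α m * β n else 0)| *
                ((Nat.totient q : ℕ) : ℝ)⁻¹
              ≤ (2 * Δ * M) * (2 ^ (j + 1) * ((4 : ℝ) ^ (q * r₀).primeFactors.card * W) *
                  Real.log hi ^ j) * ((Nat.totient q : ℕ) : ℝ)⁻¹ :=
                mul_le_mul_of_nonneg_right (hmean q hq) hφ
            _ ≤ (2 * Δ * M) * (2 ^ (j + 1) * (4 * (4 : ℝ) ^ q.primeFactors.card * W) *
                  Real.log hi ^ j) * ((Nat.totient q : ℕ) : ℝ)⁻¹ := by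
                gcongr
                exact h4 q
            _ = _ := by ring
      _ = (2 * Δ * M) * (2 ^ (j + 1) * (4 * W) * Real.log hi ^ j) *
            ∑ q ∈ (Icc 1 z).filter (fun q : ℕ => q.Coprime r₀),
              (4 : ℝ) ^ q.primeFactors.card / (Nat.totient q : ℝ) := by rw [Finset.mul_sum]
      _ ≤ (2 * Δ * M) * (2 ^ (j + 1) * (4 * W) * Real.log hi ^ j) * (1 + Real.log z) ^ 8 := by
          refine mul_le_mul_of_nonneg_left ?_ (by positivity)
          refine le_trans ?_ (sum_four_pow_div_totient_le z)
          exact Finset.sum_le_sum_of_subset_of_nonneg (Finset.filter_subset _ _)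
            (fun q _ _ => by positivity)
  have hW' : W = CP * (5 * N) * ε' ^ (-A') / Real.log xb ^ A' := by
    rw [hW, Real.mul_rpow hε'.le hlogxb.le, Real.rpow_neg hlogxb.le, div_eq_mul_inv]; ring
  have hz8 : 1 ≤ (1 + Real.log z) ^ 8 := one_le_pow₀ (by linarith)
  calc ∑ q ∈ (Icc 1 z).filter (fun q : ℕ => q.Coprime r₀), |freeSum j r₀ hi a K₀ K Δ q i l|
      = ∑ q ∈ (Icc 1 z).filter (fun q : ℕ => q.Coprime r₀), |bilinDisc (a' q) M N α β q +
          (∑ m ∈ dyadic M, ∑ n ∈ dyadic N, if (m * n).Coprime q then α m * β n else 0) /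
            (Nat.totient q : ℝ)| := Finset.sum_congr rfl fun q hq => by rw [hdecomp q hq]
    _ ≤ ∑ q ∈ (Icc 1 z).filter (fun q : ℕ => q.Coprime r₀), (|bilinDisc (a' q) M N α β q| +
          |∑ m ∈ dyadic M, ∑ n ∈ dyadic N, (if (m * n).Coprime q then α m * β n else 0)| /
            (Nat.totient q : ℝ)) := by
        refine Finset.sum_le_sum fun q _ => (abs_add_le _ _).trans (le_of_eq ?_)
        rw [abs_div, Nat.abs_cast]
    _ = ∑ q ∈ (Icc 1 z).filter (fun q : ℕ => q.Coprime r₀), |bilinDisc (a' q) M N α β q| +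
          ∑ q ∈ (Icc 1 z).filter (fun q : ℕ => q.Coprime r₀),
            |∑ m ∈ dyadic M, ∑ n ∈ dyadic N, (if (m * n).Coprime q then α m * β n else 0)| /
              (Nat.totient q : ℝ) := Finset.sum_add_distrib
    _ ≤ 2 * C₀ * Δ * xb * Real.log hi ^ j / Real.log xb ^ A' +
          (2 * Δ * M) * (2 ^ (j + 1) * (4 * W) * Real.log hi ^ j) * (1 + Real.log z) ^ 8 := by
        refine add_le_add (le_trans ?_ hBFIle) hmeansum
        exact Finset.sum_le_sum_of_subset_of_nonneg (Finset.filter_subset _ _)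
          (fun q _ _ => abs_nonneg _)
    _ ≤ (2 * C₀ + 2 ^ (j + 6) * 5 * CP * ε' ^ (-A')) * Δ * xb * Real.log hi ^ j *
          (1 + Real.log z) ^ 8 / Real.log xb ^ A' := by
        rw [hW', hxb]
        have t1 : 2 * C₀ * Δ * (M * N) * Real.log hi ^ j / Real.log xb ^ A' ≤
            2 * C₀ * Δ * (M * N) * Real.log hi ^ j * (1 + Real.log z) ^ 8 / Real.log xb ^ A' := by
          refine div_le_div_of_nonneg_right ?_ hrA
          exact le_mul_of_one_le_right (by positivity) hz8
        have t2 : (2 * Δ * M) * (2 ^ (j + 1) * (4 * (CP * (5 * N) * ε' ^ (-A') / Real.log xb ^ A')) *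
            Real.log hi ^ j) * (1 + Real.log z) ^ 8 =
            2 ^ (j + 4) * 5 * CP * ε' ^ (-A') * Δ * (M * N) * Real.log hi ^ j *
              (1 + Real.log z) ^ 8 / Real.log xb ^ A' := by
          rw [div_eq_mul_inv, div_eq_mul_inv]; ring
        have t3 : 2 ^ (j + 4) * 5 * CP * ε' ^ (-A') * Δ * (M * N) * Real.log hi ^ j *
              (1 + Real.log z) ^ 8 / Real.log xb ^ A' ≤
            2 ^ (j + 6) * 5 * CP * ε' ^ (-A') * Δ * (M * N) * Real.log hi ^ j *
              (1 + Real.log z) ^ 8 / Real.log xb ^ A' := by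
          refine div_le_div_of_nonneg_right ?_ hrA
          have : (2 : ℝ) ^ (j + 4) ≤ 2 ^ (j + 6) := pow_le_pow_right₀ (by norm_num) (by omega)
          have hε0 : 0 ≤ ε' ^ (-A') := Real.rpow_nonneg hε'.le _
          gcongr
        rw [t2]
        refine (add_le_add t1 t3).trans (le_of_eq ?_)
        ring

end Summit.Parity.BatemanHorn.Theorems
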